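/-
Copyright (c) 2026 the pub-hodgecm-mathlib formalisation cell (harness21).  Prover seat hodgecm-mathlib-K2E1-p15 (g3), Track B ∕ K2-LIT, h413 = `stmt-HodgeConjecture-24833`,
R90-TF section S8 «ContSpec-n½» (junction finding J-S8-Wform-1 of R90-CS-audit1 (g2) 2026-09-04T16:52:31Z, kernel-certified template `R90/R90-CS-audit1/g2/J_S8_Wform.cert.lean`
fdbdce6a64ce2a74 — this file is that template made an importable Theorems file): the TRANSPORT from the LAYER 2 PRINT's spelling `quasiSplit L⁺ L c 2` to socket #4′'s literal `Φ₂` bytes.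
-/
import Summits.HodgeConjecture.HodgeConjecture.Theorems.R90S8ResidualDefs               -- ★ D-S8-2′ (K2-defs1): `charLine₂`; brings ★ `cmResidualSubspaceR`, `cmParabolicDataR`, `cmUnipotentRadicalR_of_two_mul_eq`, `cmDetChar`, `lineSubrep`
import Summits.HodgeConjecture.HodgeConjecture.Theorems.K2E1SiegelRadicalCocompactU2     -- ★ `upperUnitriangular_eq_standardUnipotentRadical_two`
import Literature.NumberTheory.Automorphic.UnitaryGroupGenericity                       -- ★ `adelicUnipotent`, `quasiSplit`
import HarnessLib

/-!
# S8 #4′ road — `R90S8ResHTransportOfQuasiSplit`: the W-FORM SEAM — from «irreducibles of `L²_res(U(J))` lie in `closure ⨆_ψ ℂ·[ψ∘det]`» on Mok's spelling `J = (antidiagonal 2).over L`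
# (where ★ HEAD″ p861008, ★ LAYER 2 p862066∕p862113 and every letter payer live) to socket #4′'s FROZEN bytes on the literal `Φ₂ = (i,j) ↦ [i+j+1 = 2]` (`cmResidualSubspaceR`, `charLine₂`)

Track B ∕ K2-LIT, crux h413 = `stmt-HodgeConjecture-24833`, route of record `HCCMUnconditional`; cell `hodgecm-mathlib`, R90-TF programme, section S8 «ContSpec-n½», socket #4′
`sock_S8_resH_spannedByCharLines` (`Lines/R90_S8_ResidualSpectrumU3B.lean` ED.3 :220–:228).  THEOREMS ONLY (no `def`, no `instance`, no `notation`, no named-fact hypothesis, no `sorry`;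
default heartbeats); lane `--supports stmt-HodgeConjecture-24833 --as helper` (count-neutral).  CLOSES NO SOCKET: the quasiSplit statement enters as an explicit ∀-hypothesis (the letter-free
LAYER 2 PRINT, i.e. ★ `residual_le_topologicalClosure_iSup_charLines_of_letters` with (D)(E_blk)(O)(N_blk)(L) and the HEAD″ side conditions discharged — NOT available today); B ED.4 then pays
#4′ by `exact resH_spannedByCharLines_of_quasiSplit ‹that›` instead of a 40-line in-socket transport (auditor's ask).

THE SEAM ([folklore]; the device is ★ p855771 §2's two-step `subst`).  The two unitary data `cmDatum L 2 Φ₂` (literal `Matrix.of`) and `quasiSplit L⁺ L c 2 = cmDatum L 2 ((antidiagonal 2).over L)`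
are equal only PROPOSITIONALLY (★ `antidiagOne_eq_over`; `rfl` fails), and `cmResidualSubspaceR ∕ charLine₂ ∕ cmParabolicDataR` are typed at the literal form, so no `rw` on the socket goal
is motive-correct.  Step 1 (`resH_le_closure_charLines_of_eq`): state the quasiSplit conclusion for ANY form `J` with `hJ : (antidiagonal 2).over L = J`, the radicals written `J`-generically as
`(standardUnipotentRadical 2 1 _).comap (adelicVal … J)`, and `subst hJ` (★ `upperUnitriangular_eq_standardUnipotentRadical_two` identifies the radical with `adelicUnipotent`).  Step 2
(`resH_spannedByCharLines_of_quasiSplit`): instantiate at the literal `Φ₂` with ★ `antidiagOne_eq_over`, ★ `isUnit_antidiagOne_det`, `𝔓 := cmParabolicDataR L 2` (its one radical is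
`cmUnipotentRadicalR L 2 1 = standardUnipotentRadical 2 1` by ★ `cmUnipotentRadicalR_of_two_mul_eq`), the `cmDatum → adelicGroupData` instance ascription, and `P.space ∕ P.irreducible`
for the `DiscreteAutomorphicRep` binder — the conclusion is #4′'s bytes :221–:228 VERBATIM.  CREDIT: statement shapes and proof = R90-CS-audit1 (g2)'s cert fdbdce6a64ce2a74, token for token
(the cert imports the `Lines` file for its byte guard and is not importable; this file imports ★ `R90S8ResidualDefs` instead).
* §1 **`resH_le_closure_charLines_of_eq`** — Step 1 (`J`-generic, `subst`).
* §2 **`resH_spannedByCharLines_of_quasiSplit`** — THE JUNCTION: (quasiSplit statement, ∀ CM field) → #4′'s exact type.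
HONEST LABEL: HC_CM is proved only modulo the 7 printed citations (2 remaining named inputs: hLiu418 = `stmt-HodgeConjecture-24832`, h413 = `stmt-HodgeConjecture-24833`) until
rung 0 closes; REL ≠ ★ ≠ BUILT; this file asserts no named fact and closes no socket (#4′ stays OPEN modulo G9 + (D) + `hsrc`); count-neutral.
-/

set_option autoImplicit false
set_option linter.dupNamespace false  -- the mandated namespace `…HodgeConjecture.HodgeConjecture.R90.S8` (LEAD #1 L1) repeats the summit's segment

noncomputable section

open MeasureTheory NumberField IsDedekindDomain
open Literature.NumberTheory.GaloisRepresentations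
open Literature.NumberTheory.Automorphic.Arthur2013.Leaves.TECR
open Literature.NumberTheory.Automorphic Literature.NumberTheory.Automorphic.UnitaryGroup
open Summit.HodgeConjecture.HodgeConjecture.Cruxes.H413.K2E1CuspidalSpectrumUnitary
open Summit.HodgeConjecture.HodgeConjecture.Cruxes.H413.R90S8ResidualDefs (charLine₂)
open Summit.HodgeConjecture.HodgeConjecture.Cruxes.H413.K2E1SiegelRadicalCocompactU2 (upperUnitriangular_eq_standardUnipotentRadical_two)

namespace Summit.HodgeConjecture.HodgeConjecture.R90.S8

/-! ## §1 Step 1: any form `J` equal to the antidiagonal one (`subst`) -/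

/-- **Step 1 of the seam** (`J`-generic): if the quasiSplit statement «every irreducible closed `P ≤ L²_res(U((antidiagonal 2).over L), 𝔓)`, `𝔓`'s radicals `= N(𝔸)`, lies in `closure ⨆_ψ ℂ·[ψ∘det]`»
holds, then the same holds on `U(J)` for ANY `J` with `(antidiagonal 2).over L = J` and radicals written `J`-generically as the pull-back of the standard `(1,1)` unipotent radical — by `subst`
and ★ `upperUnitriangular_eq_standardUnipotentRadical_two`. [folklore] -/
theorem resH_le_closure_charLines_of_eq {L : Type} [Field L] [NumberField L] [IsCMField L]
    (H : ∀ (μ : Measure (quasiSplit (↥(maximalRealSubfield L)) L (IsCMField.complexConj L) 2).automorphicQuotient)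
      [(quasiSplit (↥(maximalRealSubfield L)) L (IsCMField.complexConj L) 2).IsAutomorphicMeasure μ]
      (𝔓 : (quasiSplit (↥(maximalRealSubfield L)) L (IsCMField.complexConj L) 2).ParabolicUnipotentData)
      (_ : ∀ j : 𝔓.ι, 𝔓.radical j = adelicUnipotent (↥(maximalRealSubfield L)) L (IsCMField.complexConj L) 2)
      (P : ContRepresentation.ClosedSubrep ((quasiSplit (↥(maximalRealSubfield L)) L (IsCMField.complexConj L) 2).rightRegular μ)),
      P.toContRep.IsTopIrreducible → P ≤ residualSubspace (quasiSplit (↥(maximalRealSubfield L)) L (IsCMField.complexConj L) 2) μ 𝔓 →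
      P.toSubmodule ≤ (⨆ ψ : {ψ : ↥(TorusDict.torus (IsCMField.complexConj L)) →ₜ* ℂˣ // TorusDict.IsAutomorphic (IsCMField.complexConj L) ψ},
          (AdelicGroupData.AutomorphicCharacter.lineSubrep (𝒢 := (quasiSplit (↥(maximalRealSubfield L)) L (IsCMField.complexConj L) 2))
            (cmDetChar L 2 ((StdForm.antidiagonal 2).over L) ψ.1 ψ.2 ((Matrix.isUnit_iff_isUnit_det _).mp (StdForm.isUnit_over (StdForm.antidiagonal 2) L)).ne_zero) μ).toSubmodule).topologicalClosure)
    {J : Matrix (Fin 2) (Fin 2) L} (hJ : (StdForm.antidiagonal 2).over L = J) (hJd : J.det ≠ 0)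
    (μ : Measure (adelicGroupData (↥(maximalRealSubfield L)) L (IsCMField.complexConj L) 2 J).automorphicQuotient)
    [(adelicGroupData (↥(maximalRealSubfield L)) L (IsCMField.complexConj L) 2 J).IsAutomorphicMeasure μ]
    (𝔓 : (adelicGroupData (↥(maximalRealSubfield L)) L (IsCMField.complexConj L) 2 J).ParabolicUnipotentData)
    (h𝔓 : ∀ j : 𝔓.ι, 𝔓.radical j = (standardUnipotentRadical 2 1 (AdeleRing (𝓞 L) L)).comap (adelicVal (↥(maximalRealSubfield L)) L (IsCMField.complexConj L) 2 J))
    (P : ContRepresentation.ClosedSubrep ((adelicGroupData (↥(maximalRealSubfield L)) L (IsCMField.complexConj L) 2 J).rightRegular μ))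
    (hP : P.toContRep.IsTopIrreducible) (hPres : P ≤ residualSubspace (adelicGroupData (↥(maximalRealSubfield L)) L (IsCMField.complexConj L) 2 J) μ 𝔓) :
    P.toSubmodule ≤ (⨆ ψ : {ψ : ↥(TorusDict.torus (IsCMField.complexConj L)) →ₜ* ℂˣ // TorusDict.IsAutomorphic (IsCMField.complexConj L) ψ},
        (AdelicGroupData.AutomorphicCharacter.lineSubrep (𝒢 := (adelicGroupData (↥(maximalRealSubfield L)) L (IsCMField.complexConj L) 2 J))
          (cmDetChar L 2 J ψ.1 ψ.2 hJd) μ).toSubmodule).topologicalClosure := by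
  subst hJ
  have h𝔓' : ∀ j : 𝔓.ι, 𝔓.radical j = adelicUnipotent (↥(maximalRealSubfield L)) L (IsCMField.complexConj L) 2 := fun j => by
    rw [h𝔓 j]
    show _ = (upperUnitriangular (Fin 2) (AdeleRing (𝓞 L) L)).comap _
    rw [upperUnitriangular_eq_standardUnipotentRadical_two]
  exact H μ 𝔓 h𝔓' P hP hPres

/-! ## §2 Step 2: the junction to #4′'s frozen bytes -/

/-- **THE JUNCTION (J-S8-Wform-1) — the quasiSplit statement for every CM field yields socket #4′'s EXACT type** (`Lines/R90_S8_ResidualSpectrumU3B.lean` ED.3 :221–:228, literal `Φ₂`,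
`cmResidualSubspaceR`, `charLine₂`, `DiscreteAutomorphicRep`): Step 1 at `J := Φ₂` (★ `antidiagOne_eq_over`, ★ `isUnit_antidiagOne_det`), `𝔓 := cmParabolicDataR L 2` (single radical
`cmUnipotentRadicalR L 2 1 = standardUnipotentRadical 2 1`, ★ `cmUnipotentRadicalR_of_two_mul_eq`), instance ascription `cmDatum → adelicGroupData`, `P.space ∕ P.irreducible`.
B ED.4 pays #4′ by `exact resH_spannedByCharLines_of_quasiSplit ‹letter-free LAYER 2 PRINT›`.  Shapes and proof: R90-CS-audit1 (g2)'s kernel cert fdbdce6a64ce2a74. [folklore] -/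
theorem resH_spannedByCharLines_of_quasiSplit
    (H : ∀ (L : Type) [Field L] [NumberField L] [IsCMField L]
      (μ : Measure (quasiSplit (↥(maximalRealSubfield L)) L (IsCMField.complexConj L) 2).automorphicQuotient)
      [(quasiSplit (↥(maximalRealSubfield L)) L (IsCMField.complexConj L) 2).IsAutomorphicMeasure μ]
      (𝔓 : (quasiSplit (↥(maximalRealSubfield L)) L (IsCMField.complexConj L) 2).ParabolicUnipotentData)
      (_ : ∀ j : 𝔓.ι, 𝔓.radical j = adelicUnipotent (↥(maximalRealSubfield L)) L (IsCMField.complexConj L) 2)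
      (P : ContRepresentation.ClosedSubrep ((quasiSplit (↥(maximalRealSubfield L)) L (IsCMField.complexConj L) 2).rightRegular μ)),
      P.toContRep.IsTopIrreducible → P ≤ residualSubspace (quasiSplit (↥(maximalRealSubfield L)) L (IsCMField.complexConj L) 2) μ 𝔓 →
      P.toSubmodule ≤ (⨆ ψ : {ψ : ↥(TorusDict.torus (IsCMField.complexConj L)) →ₜ* ℂˣ // TorusDict.IsAutomorphic (IsCMField.complexConj L) ψ},
          (AdelicGroupData.AutomorphicCharacter.lineSubrep (𝒢 := (quasiSplit (↥(maximalRealSubfield L)) L (IsCMField.complexConj L) 2))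
            (cmDetChar L 2 ((StdForm.antidiagonal 2).over L) ψ.1 ψ.2 ((Matrix.isUnit_iff_isUnit_det _).mp (StdForm.isUnit_over (StdForm.antidiagonal 2) L)).ne_zero) μ).toSubmodule).topologicalClosure) :
    ∀ (L : Type) [Field L] [NumberField L] [IsCMField L]
      (μ₂ : Measure (UnitaryGroup.cmDatum L 2 (Matrix.of fun i j : Fin 2 => if i.val + j.val + 1 = 2 then (1 : L) else 0)).automorphicQuotient)
      [(UnitaryGroup.cmDatum L 2 (Matrix.of fun i j : Fin 2 => if i.val + j.val + 1 = 2 then (1 : L) else 0)).IsAutomorphicMeasure μ₂]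
      (P : DiscreteAutomorphicRep (UnitaryGroup.cmDatum L 2 (Matrix.of fun i j : Fin 2 => if i.val + j.val + 1 = 2 then (1 : L) else 0)) μ₂),
      P.space ≤ cmResidualSubspaceR L 2 μ₂ →
      P.space.toSubmodule ≤
        (⨆ ψ : {ψ : ↥(TorusDict.torus (IsCMField.complexConj L)) →ₜ* ℂˣ // TorusDict.IsAutomorphic (IsCMField.complexConj L) ψ},
            (charLine₂ L ψ.1 ψ.2 μ₂).toSubmodule).topologicalClosure := by
  intro L _ _ _ μ₂ _ P hP
  haveI : (adelicGroupData (↥(maximalRealSubfield L)) L (IsCMField.complexConj L) 2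
      (Matrix.of fun i j : Fin 2 => if i.val + j.val + 1 = 2 then (1 : L) else 0)).IsAutomorphicMeasure μ₂ :=
    ‹(UnitaryGroup.cmDatum L 2 (Matrix.of fun i j : Fin 2 => if i.val + j.val + 1 = 2 then (1 : L) else 0)).IsAutomorphicMeasure μ₂›
  have hrad : ∀ j : (cmParabolicDataR L 2).ι, (cmParabolicDataR L 2).radical j =
      (standardUnipotentRadical 2 1 (AdeleRing (𝓞 L) L)).comap
        (adelicVal (↥(maximalRealSubfield L)) L (IsCMField.complexConj L) 2 (Matrix.of fun i j : Fin 2 => if i.val + j.val + 1 = 2 then (1 : L) else 0)) := by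
    rintro ⟨k, hk1, hk2⟩
    have hk : k = 1 := by omega
    subst hk
    show cmUnipotentRadicalR L 2 1 = _
    rw [cmUnipotentRadicalR_of_two_mul_eq L 2 1 rfl]
    rfl
  exact resH_le_closure_charLines_of_eq (H L) (antidiagOne_eq_over L 2).symm (isUnit_antidiagOne_det L 2).ne_zero μ₂ (cmParabolicDataR L 2) hrad
    P.space P.irreducible hP

end Summit.HodgeConjecture.HodgeConjecture.R90.S8

end
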